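import Summits.Ventures.GridStability.Bench.GFMSMIBDeg2AQoriaV4physK32Data
import Mathlib.Tactic.LinearCombination
import Mathlib.Tactic.Positivity

/-!
# GFMSMIBDeg2AQoriaV4physK32 — THEOREMS part (kernel checks + certified inequalities)

Data (model block, `Poly`/`GramSOS`/`CertG` literals) live in `GFMSMIBDeg2AQoriaV4physK32Data.lean` (statement-only sibling);
this file holds one `SOS.Poly.checkG … = true := by decide +kernel` theorem per identity and the real-variable
inequalities derived by `nonneg_of_checkG`. See the Data file's docstring for the THREE-COLUMN text, model, provenance.
-/

namespace Summit.Ventures.GridStability.Bench.GFMSMIB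

open Literature.Computation.Certificates Literature.Computation.Certificates.SOS
open Literature.Computation.Certificates.SOS.Poly

/-- KERNEL CHECK `deg2_A_QoriaV4phys_k32_V_pos`: every Gram block passes `PSD.IsGramCertDD` and the residual `p − (σ₀ + Σ gᵢσᵢ + Σ hⱼtⱼ)` is the zero polynomial (`SOS.Poly.checkG`, ONE reduction). [folklore] -/
theorem deg2_A_QoriaV4phys_k32_V_pos_check : checkG deg2_A_QoriaV4phys_k32_V_pos_p deg2_A_QoriaV4phys_k32_V_pos_gs deg2_A_QoriaV4phys_k32_V_pos_hs deg2_A_QoriaV4phys_k32_V_pos_cert = true := by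
  decide +kernel

/-- KERNEL CHECK `deg2_A_QoriaV4phys_k32_Vdot_neg`: every Gram block passes `PSD.IsGramCertDD` and the residual `p − (σ₀ + Σ gᵢσᵢ + Σ hⱼtⱼ)` is the zero polynomial (`SOS.Poly.checkG`, ONE reduction). [folklore] -/
theorem deg2_A_QoriaV4phys_k32_Vdot_neg_check : checkG deg2_A_QoriaV4phys_k32_Vdot_neg_p deg2_A_QoriaV4phys_k32_Vdot_neg_gs deg2_A_QoriaV4phys_k32_Vdot_neg_hs deg2_A_QoriaV4phys_k32_Vdot_neg_cert = true := by
  decide +kernel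

/-- KERNEL CHECK `deg2_A_QoriaV4phys_k32_level_in_ball`: every Gram block passes `PSD.IsGramCertDD` and the residual `p − (σ₀ + Σ gᵢσᵢ + Σ hⱼtⱼ)` is the zero polynomial (`SOS.Poly.checkG`, ONE reduction). [folklore] -/
theorem deg2_A_QoriaV4phys_k32_level_in_ball_check : checkG deg2_A_QoriaV4phys_k32_level_in_ball_p deg2_A_QoriaV4phys_k32_level_in_ball_gs deg2_A_QoriaV4phys_k32_level_in_ball_hs deg2_A_QoriaV4phys_k32_level_in_ball_cert = true := by
  decide +kernel

/-- KERNEL CHECK `deg2_A_QoriaV4phys_k32_arc_excl`: every Gram block passes `PSD.IsGramCertDD` and the residual `p − (σ₀ + Σ gᵢσᵢ + Σ hⱼtⱼ)` is the zero polynomial (`SOS.Poly.checkG`, ONE reduction). [folklore] -/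
theorem deg2_A_QoriaV4phys_k32_arc_excl_check : checkG deg2_A_QoriaV4phys_k32_arc_excl_p deg2_A_QoriaV4phys_k32_arc_excl_gs deg2_A_QoriaV4phys_k32_arc_excl_hs deg2_A_QoriaV4phys_k32_arc_excl_cert = true := by
  decide +kernel

/-- **`deg2_A_QoriaV4phys_k32_V_pos`** (CERTIFIED, model `GFM-SMIB instance GFM-SMIB-QoriaV4-phys
(model-1 I2 file, f verbatim)`; ALGEBRAIC inequality, ROA inclusion pending Lyapunov/ lemma): V -
eps_pos*phi >= 0 on {h = 0} — for every real point satisfying the listed hypotheses (hh). [folklore] -/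
theorem deg2_A_QoriaV4phys_k32_V_pos (sigma kappa omega : ℝ) (hh : deg2_A_QoriaV4phys_k32_h sigma kappa omega = 0) :
    (1 / 100 : ℝ) * (((1 : ℝ) / 4500) * omega ^ 2 + (1 : ℝ) * kappa ^ 2 + (1 : ℝ) * sigma ^ 2) ≤ deg2_A_QoriaV4phys_k32_V sigma kappa omega := by
  simp only [deg2_A_QoriaV4phys_k32_V, deg2_A_QoriaV4phys_k32_V_poly, eval_cons, eval_nil, Monomial.eval_eq, Monomial.evalFrom_cons, Monomial.evalFrom_nil,
        vars_cons_zero, vars_cons_succ]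
  push_cast
  simp only [deg2_A_QoriaV4phys_k32_h, deg2_A_QoriaV4phys_k32_h_poly, eval_cons, eval_nil, Monomial.eval_eq, Monomial.evalFrom_cons, Monomial.evalFrom_nil,
        vars_cons_zero, vars_cons_succ] at hh
  push_cast at hh
  have h := nonneg_of_checkG deg2_A_QoriaV4phys_k32_V_pos_check (vars [sigma, kappa, omega])
    (by simp [deg2_A_QoriaV4phys_k32_V_pos_gs])
    (by
      intro q hq
      simp only [deg2_A_QoriaV4phys_k32_V_pos_hs, List.mem_cons, List.not_mem_nil, or_false] at hq
      rcases hq with rfl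
      · simp only [eval_cons, eval_nil, Monomial.eval_eq, Monomial.evalFrom_cons, Monomial.evalFrom_nil,
        vars_cons_zero, vars_cons_succ]
        push_cast
        linear_combination hh)
  simp only [deg2_A_QoriaV4phys_k32_V_pos_p, eval_cons, eval_nil, Monomial.eval_eq, Monomial.evalFrom_cons, Monomial.evalFrom_nil,
        vars_cons_zero, vars_cons_succ] at h
  push_cast at h
  linear_combination h

/-- **`deg2_A_QoriaV4phys_k32_Vdot_neg`** (CERTIFIED, model `GFM-SMIB instance GFM-SMIB-QoriaV4-phys
(model-1 I2 file, f verbatim)`; ALGEBRAIC inequality, ROA inclusion pending Lyapunov/ lemma): -Vdot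
- eps_dot*phi >= 0 on {level - V >= 0} cap {r2 - phi >= 0} cap {h = 0} (Vdot = grad V . f; the ball
hypothesis is D itself and is implied on {V <= level} cap {h=0} by level_in_ball) — for every real
point satisfying the listed hypotheses (hV, hD1, hh). [folklore] -/
theorem deg2_A_QoriaV4phys_k32_Vdot_neg (sigma kappa omega : ℝ) (hV : deg2_A_QoriaV4phys_k32_V sigma kappa omega ≤ (83 : ℝ)) (hD1 : 0 ≤ ((-1 : ℝ) / 4500) * omega ^ 2 + (-1 : ℝ) * kappa ^ 2 + (-1 : ℝ) * sigma ^ 2 + (3 : ℝ)) (hh : deg2_A_QoriaV4phys_k32_h sigma kappa omega = 0) :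
    deg2_A_QoriaV4phys_k32_Vdot sigma kappa omega ≤ -(1 / 2000 : ℝ) * (((1 : ℝ) / 4500) * omega ^ 2 + (1 : ℝ) * kappa ^ 2 + (1 : ℝ) * sigma ^ 2) := by
  simp only [deg2_A_QoriaV4phys_k32_Vdot, deg2_A_QoriaV4phys_k32_Vdot_poly, eval_cons, eval_nil, Monomial.eval_eq, Monomial.evalFrom_cons, Monomial.evalFrom_nil,
        vars_cons_zero, vars_cons_succ]
  push_cast
  simp only [deg2_A_QoriaV4phys_k32_V, deg2_A_QoriaV4phys_k32_V_poly, eval_cons, eval_nil, Monomial.eval_eq, Monomial.evalFrom_cons, Monomial.evalFrom_nil,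
        vars_cons_zero, vars_cons_succ] at hV
  push_cast at hV
  simp only [deg2_A_QoriaV4phys_k32_h, deg2_A_QoriaV4phys_k32_h_poly, eval_cons, eval_nil, Monomial.eval_eq, Monomial.evalFrom_cons, Monomial.evalFrom_nil,
        vars_cons_zero, vars_cons_succ] at hh
  push_cast at hh
  have h := nonneg_of_checkG deg2_A_QoriaV4phys_k32_Vdot_neg_check (vars [sigma, kappa, omega])
    (by
      intro g hg
      simp only [deg2_A_QoriaV4phys_k32_Vdot_neg_gs, List.mem_cons, List.not_mem_nil, or_false] at hg
      rcases hg with rfl | rfl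
      · simp only [eval_cons, eval_nil, Monomial.eval_eq, Monomial.evalFrom_cons, Monomial.evalFrom_nil,
        vars_cons_zero, vars_cons_succ]
        push_cast
        linear_combination hV
      · simp only [eval_cons, eval_nil, Monomial.eval_eq, Monomial.evalFrom_cons, Monomial.evalFrom_nil,
        vars_cons_zero, vars_cons_succ]
        push_cast
        linear_combination hD1)
    (by
      intro q hq
      simp only [deg2_A_QoriaV4phys_k32_Vdot_neg_hs, List.mem_cons, List.not_mem_nil, or_false] at hq
      rcases hq with rfl
      · simp only [eval_cons, eval_nil, Monomial.eval_eq, Monomial.evalFrom_cons, Monomial.evalFrom_nil,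
        vars_cons_zero, vars_cons_succ]
        push_cast
        linear_combination hh)
  simp only [deg2_A_QoriaV4phys_k32_Vdot_neg_p, eval_cons, eval_nil, Monomial.eval_eq, Monomial.evalFrom_cons, Monomial.evalFrom_nil,
        vars_cons_zero, vars_cons_succ] at h
  push_cast at h
  linear_combination h

/-- **`deg2_A_QoriaV4phys_k32_level_in_ball`** (CERTIFIED, model `GFM-SMIB instance
GFM-SMIB-QoriaV4-phys (model-1 I2 file, f verbatim)`; ALGEBRAIC inequality, ROA inclusion pending
Lyapunov/ lemma): r2 - phi >= 0 on {level - V >= 0} cap {h = 0} (typed inclusion {V <= level} cap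
{h=0} in D = {phi <= r2}, PARTITION A2) — for every real point satisfying the listed hypotheses (hV,
hh). [folklore] -/
theorem deg2_A_QoriaV4phys_k32_level_in_ball (sigma kappa omega : ℝ) (hV : deg2_A_QoriaV4phys_k32_V sigma kappa omega ≤ (83 : ℝ)) (hh : deg2_A_QoriaV4phys_k32_h sigma kappa omega = 0) :
    ((1 : ℝ) / 4500) * omega ^ 2 + (1 : ℝ) * kappa ^ 2 + (1 : ℝ) * sigma ^ 2 ≤ (3 : ℝ) := by
  simp only [deg2_A_QoriaV4phys_k32_V, deg2_A_QoriaV4phys_k32_V_poly, eval_cons, eval_nil, Monomial.eval_eq, Monomial.evalFrom_cons, Monomial.evalFrom_nil,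
        vars_cons_zero, vars_cons_succ] at hV
  push_cast at hV
  simp only [deg2_A_QoriaV4phys_k32_h, deg2_A_QoriaV4phys_k32_h_poly, eval_cons, eval_nil, Monomial.eval_eq, Monomial.evalFrom_cons, Monomial.evalFrom_nil,
        vars_cons_zero, vars_cons_succ] at hh
  push_cast at hh
  have h := nonneg_of_checkG deg2_A_QoriaV4phys_k32_level_in_ball_check (vars [sigma, kappa, omega])
    (by
      intro g hg
      simp only [deg2_A_QoriaV4phys_k32_level_in_ball_gs, List.mem_cons, List.not_mem_nil, or_false] at hg
      rcases hg with rfl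
      · simp only [eval_cons, eval_nil, Monomial.eval_eq, Monomial.evalFrom_cons, Monomial.evalFrom_nil,
        vars_cons_zero, vars_cons_succ]
        push_cast
        linear_combination hV)
    (by
      intro q hq
      simp only [deg2_A_QoriaV4phys_k32_level_in_ball_hs, List.mem_cons, List.not_mem_nil, or_false] at hq
      rcases hq with rfl
      · simp only [eval_cons, eval_nil, Monomial.eval_eq, Monomial.evalFrom_cons, Monomial.evalFrom_nil,
        vars_cons_zero, vars_cons_succ]
        push_cast
        linear_combination hh)
  simp only [deg2_A_QoriaV4phys_k32_level_in_ball_p, eval_cons, eval_nil, Monomial.eval_eq, Monomial.evalFrom_cons, Monomial.evalFrom_nil,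
        vars_cons_zero, vars_cons_succ] at h
  push_cast at h
  linear_combination h

/-- **`deg2_A_QoriaV4phys_k32_arc_excl`** (CERTIFIED, model `GFM-SMIB instance GFM-SMIB-QoriaV4-phys
(model-1 I2 file, f verbatim)`; ALGEBRAIC inequality, ROA inclusion pending Lyapunov/ lemma):
kappa_max - kappa >= 0 on {level - V >= 0} cap {h = 0} (arc exclusion kappa = 1 - cos(u) <=
kappa_max < 2: director RULING 3 (4) / MODEL-VALIDITY MV-1(e)) — for every real point satisfying the
listed hypotheses (hV, hh). [folklore] -/
theorem deg2_A_QoriaV4phys_k32_arc_excl (sigma kappa omega : ℝ) (hV : deg2_A_QoriaV4phys_k32_V sigma kappa omega ≤ (83 : ℝ)) (hh : deg2_A_QoriaV4phys_k32_h sigma kappa omega = 0) :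
    kappa ≤ (3 / 2 : ℝ) := by
  simp only [deg2_A_QoriaV4phys_k32_V, deg2_A_QoriaV4phys_k32_V_poly, eval_cons, eval_nil, Monomial.eval_eq, Monomial.evalFrom_cons, Monomial.evalFrom_nil,
        vars_cons_zero, vars_cons_succ] at hV
  push_cast at hV
  simp only [deg2_A_QoriaV4phys_k32_h, deg2_A_QoriaV4phys_k32_h_poly, eval_cons, eval_nil, Monomial.eval_eq, Monomial.evalFrom_cons, Monomial.evalFrom_nil,
        vars_cons_zero, vars_cons_succ] at hh
  push_cast at hh
  have h := nonneg_of_checkG deg2_A_QoriaV4phys_k32_arc_excl_check (vars [sigma, kappa, omega])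
    (by
      intro g hg
      simp only [deg2_A_QoriaV4phys_k32_arc_excl_gs, List.mem_cons, List.not_mem_nil, or_false] at hg
      rcases hg with rfl
      · simp only [eval_cons, eval_nil, Monomial.eval_eq, Monomial.evalFrom_cons, Monomial.evalFrom_nil,
        vars_cons_zero, vars_cons_succ]
        push_cast
        linear_combination hV)
    (by
      intro q hq
      simp only [deg2_A_QoriaV4phys_k32_arc_excl_hs, List.mem_cons, List.not_mem_nil, or_false] at hq
      rcases hq with rfl
      · simp only [eval_cons, eval_nil, Monomial.eval_eq, Monomial.evalFrom_cons, Monomial.evalFrom_nil,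
        vars_cons_zero, vars_cons_succ]
        push_cast
        linear_combination hh)
  simp only [deg2_A_QoriaV4phys_k32_arc_excl_p, eval_cons, eval_nil, Monomial.eval_eq, Monomial.evalFrom_cons, Monomial.evalFrom_nil,
        vars_cons_zero, vars_cons_succ] at h
  push_cast at h
  linear_combination h

/-- **Certificate `GFM-SMIB-deg2-A-QoriaV4phys-k32`** (CERTIFIED, model `GFM-SMIB instance
GFM-SMIB-QoriaV4-phys (model-1 I2 file, f verbatim)`; README §3 T3 shape): under the listed
hypotheses (hh, hV, hD1) all 4 certified inequalities hold. «algebraic inequalities certified; ROA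
inclusion pending Lyapunov/ lemma» (PARTITION A2). [folklore] -/
theorem deg2_A_QoriaV4phys_k32_certificate (sigma kappa omega : ℝ) (hh : deg2_A_QoriaV4phys_k32_h sigma kappa omega = 0) (hV : deg2_A_QoriaV4phys_k32_V sigma kappa omega ≤ (83 : ℝ)) (hD1 : 0 ≤ ((-1 : ℝ) / 4500) * omega ^ 2 + (-1 : ℝ) * kappa ^ 2 + (-1 : ℝ) * sigma ^ 2 + (3 : ℝ)) :
    (1 / 100 : ℝ) * (((1 : ℝ) / 4500) * omega ^ 2 + (1 : ℝ) * kappa ^ 2 + (1 : ℝ) * sigma ^ 2) ≤ deg2_A_QoriaV4phys_k32_V sigma kappa omega ∧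
    deg2_A_QoriaV4phys_k32_Vdot sigma kappa omega ≤ -(1 / 2000 : ℝ) * (((1 : ℝ) / 4500) * omega ^ 2 + (1 : ℝ) * kappa ^ 2 + (1 : ℝ) * sigma ^ 2) ∧
    ((1 : ℝ) / 4500) * omega ^ 2 + (1 : ℝ) * kappa ^ 2 + (1 : ℝ) * sigma ^ 2 ≤ (3 : ℝ) ∧
    kappa ≤ (3 / 2 : ℝ) :=
  ⟨deg2_A_QoriaV4phys_k32_V_pos sigma kappa omega hh, deg2_A_QoriaV4phys_k32_Vdot_neg sigma kappa omega hV hD1 hh, deg2_A_QoriaV4phys_k32_level_in_ball sigma kappa omega hV hh, deg2_A_QoriaV4phys_k32_arc_excl sigma kappa omega hV hh⟩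

/-- `deg2_A_QoriaV4phys_k32_f_sigma` written out as an explicit real polynomial (2 terms). [folklore] -/
theorem deg2_A_QoriaV4phys_k32_f_sigma_eq (sigma kappa omega : ℝ) :
    deg2_A_QoriaV4phys_k32_f_sigma sigma kappa omega = (-1 : ℝ) * kappa * omega + (1 : ℝ) * omega := by
  simp only [deg2_A_QoriaV4phys_k32_f_sigma, deg2_A_QoriaV4phys_k32_f_sigma_poly, eval_cons, eval_nil, Monomial.eval_eq, Monomial.evalFrom_cons, Monomial.evalFrom_nil,
        vars_cons_zero, vars_cons_succ]
  push_cast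
  ring

/-- `deg2_A_QoriaV4phys_k32_f_kappa` written out as an explicit real polynomial (1 terms). [folklore] -/
theorem deg2_A_QoriaV4phys_k32_f_kappa_eq (sigma kappa omega : ℝ) :
    deg2_A_QoriaV4phys_k32_f_kappa sigma kappa omega = (1 : ℝ) * sigma * omega := by
  simp only [deg2_A_QoriaV4phys_k32_f_kappa, deg2_A_QoriaV4phys_k32_f_kappa_poly, eval_cons, eval_nil, Monomial.eval_eq, Monomial.evalFrom_cons, Monomial.evalFrom_nil,
        vars_cons_zero, vars_cons_succ]
  push_cast
  ring

/-- `deg2_A_QoriaV4phys_k32_f_omega` written out as an explicit real polynomial (3 terms). [folklore] -/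
theorem deg2_A_QoriaV4phys_k32_f_omega_eq (sigma kappa omega : ℝ) :
    deg2_A_QoriaV4phys_k32_f_omega sigma kappa omega = (-33 : ℝ) * omega + ((29431488000 : ℝ) / 1873666673) * kappa + ((-233605208200 : ℝ) / 1873666673) * sigma := by
  simp only [deg2_A_QoriaV4phys_k32_f_omega, deg2_A_QoriaV4phys_k32_f_omega_poly, eval_cons, eval_nil, Monomial.eval_eq, Monomial.evalFrom_cons, Monomial.evalFrom_nil,
        vars_cons_zero, vars_cons_succ]
  push_cast
  ring

/-- `deg2_A_QoriaV4phys_k32_h` written out as an explicit real polynomial (3 terms). [folklore] -/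
theorem deg2_A_QoriaV4phys_k32_h_eq (sigma kappa omega : ℝ) :
    deg2_A_QoriaV4phys_k32_h sigma kappa omega = (1 : ℝ) * kappa ^ 2 + (1 : ℝ) * sigma ^ 2 + (-2 : ℝ) * kappa := by
  simp only [deg2_A_QoriaV4phys_k32_h, deg2_A_QoriaV4phys_k32_h_poly, eval_cons, eval_nil, Monomial.eval_eq, Monomial.evalFrom_cons, Monomial.evalFrom_nil,
        vars_cons_zero, vars_cons_succ]
  push_cast
  ring

/-- `deg2_A_QoriaV4phys_k32_V` written out as an explicit real polynomial (7 terms). [folklore] -/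
theorem deg2_A_QoriaV4phys_k32_V_eq (sigma kappa omega : ℝ) :
    deg2_A_QoriaV4phys_k32_V sigma kappa omega = ((2049 : ℝ) / 5000) * omega ^ 2 + ((-907 : ℝ) / 10000) * kappa * omega + ((201721 : ℝ) / 10000) * kappa ^ 2 + ((2281 : ℝ) / 10000) * sigma * omega + ((-8611 : ℝ) / 10000) * sigma * kappa + ((48699 : ℝ) / 2500) * sigma ^ 2 + ((33169 : ℝ) / 2000) * kappa := by
  simp only [deg2_A_QoriaV4phys_k32_V, deg2_A_QoriaV4phys_k32_V_poly, eval_cons, eval_nil, Monomial.eval_eq, Monomial.evalFrom_cons, Monomial.evalFrom_nil,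
        vars_cons_zero, vars_cons_succ]
  push_cast
  ring

/-- `deg2_A_QoriaV4phys_k32_Vdot` written out as an explicit real polynomial (11 terms). [folklore] -/
theorem deg2_A_QoriaV4phys_k32_Vdot_eq (sigma kappa omega : ℝ) :
    deg2_A_QoriaV4phys_k32_Vdot sigma kappa omega = ((-2281 : ℝ) / 10000) * kappa * omega ^ 2 + ((8611 : ℝ) / 10000) * kappa ^ 2 * omega + ((-907 : ℝ) / 10000) * sigma * omega ^ 2 + ((277 : ℝ) / 200) * sigma * kappa * omega + ((-8611 : ℝ) / 10000) * sigma ^ 2 * omega + ((-268187 : ℝ) / 10000) * omega ^ 2 + ((7029176227909 : ℝ) / 468416668250) * kappa * omega + ((-13347179808 : ℝ) / 9368333365) * kappa ^ 2 + ((-253740250508207 : ℝ) / 4684166682500) * sigma * omega + ((1395065739827 : ℝ) / 93683333650) * sigma * kappa + ((-2664267399521 : ℝ) / 93683333650) * sigma ^ 2 := by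
  simp only [deg2_A_QoriaV4phys_k32_Vdot, deg2_A_QoriaV4phys_k32_Vdot_poly, eval_cons, eval_nil, Monomial.eval_eq, Monomial.evalFrom_cons, Monomial.evalFrom_nil,
        vars_cons_zero, vars_cons_succ]
  push_cast
  ring

end Summit.Ventures.GridStability.Bench.GFMSMIB
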